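import Mathlib
import Summits.NavierStokesRegularity.NavierStokesRegularity.Theorems.EulerZoomLiouvillePowerGaugeEulerLiouvilleCondenserWeightedBudgetVanishing

/-!
# E-TAIL: a finite weighted energy `∫‖DV‖²‖y‖^{ρ−1} < ∞` has dyadic shell energy `o(R^{1−ρ})` (LEAD 19832 g15; nsreg-p2 ROUND-50 plate t53-ET, text VERBATIM)

Class-free tool for crux `EulerZoomLiouville.PowerGaugeEulerLiouville` (stmt-NavierStokesRegularity-19832), LEAD ns-typeII-p2 g15, `--supports … --as helper`.
nsreg-p2 g40's ROUND-50 «THE WALL COMES FOR FREE» (HOME/ns-regularity-ideate-p2/ROUND-50.md v1.0 57199fa43a942d94, `r50/Sketch50.lean` 6c31f8f6e879902e, Prop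
`NsregP2.R50.EnergyTail ρ`, l.148–153): if `∫⁻ ‖DV y‖ₑ²·‖y‖^{ρ−1} dy ≠ ∞` and `ρ < 1` then for every `ε > 0`, for all large `R`,
`∫⁻_{R ≤ ‖y‖ ≤ 2R} ‖DV‖ₑ² ≤ ε·R^{1−ρ}` (`= ε R² b`, `b = R^{−1−ρ}`).  For class members the hypothesis is `NeedleThinCore.selfSimilar_needle_inputs` (E); the conclusion
replaces the WHOLE budget `(1−ρ)c/(2+ρ)·(2R)^{1−ρ}` in every cofinal-in-`R` run / needle contradiction, so the class constant `c` disappears from the face constraint — the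
input (M0′) of the alt-8′ member `HasStraightSlowHighRunsFree` (R50 §3).  Proof: the LEAD g14 o-form tool `Condenser.setLIntegral_closedBall_eventually_le_of_weight`
(p685310; `a = ρ − 1 < 0`, `f = ‖DV‖ₑ²`) at `ε/2^{1−ρ}`, and the shell is inside `B̄(0,2R)`.

* `Condenser.setLIntegral_shell_fderiv_sq_eventually_le` — the statement with named hypotheses;
* `Condenser.energyTail (ρ) : <NsregP2.R50.EnergyTail ρ VERBATIM>` — kernel `example` against Sketch50 checked in the LEAD's scratch.

WHAT THIS IS NOT: not NS, not E — a measure-theoretic corollary on the MODEL lattice; 19832 OPEN; NS regularity NOT proved. [folklore (dominated convergence)]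
-/

noncomputable section

open Set Filter Topology Metric Function MeasureTheory Real
open scoped NNReal ENNReal

set_option linter.dupNamespace false

namespace Summit.NavierStokesRegularity.NavierStokesRegularity.Theorems.PowerGaugeEulerLiouville.Condenser

/-- **E-TAIL (named hypotheses).**  `ρ < 1`, `V ∈ C¹`, `∫⁻ ‖DV y‖ₑ²·‖y‖^{ρ−1} ≠ ∞`, `ε > 0` ⇒ `∃ R₁, ∀ R ≥ R₁, ∫⁻_{B̄(0,2R) ∖ B(0,R)} ‖DV‖ₑ² ≤ ofReal (ε·R^{1−ρ})`.
(`R₁ ≥ 1`; the shell integral is bounded by the ball integral over `B̄(0,2R)`, which is `≤ (ε/2^{1−ρ})·(2R)^{1−ρ}` for `2R ≥ L₀` by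
`setLIntegral_closedBall_eventually_le_of_weight`.) [folklore] -/
theorem setLIntegral_shell_fderiv_sq_eventually_le {ρ : ℝ} (hρ1 : ρ < 1)
    {V : EuclideanSpace ℝ (Fin 3) → EuclideanSpace ℝ (Fin 3)} (hV : ContDiff ℝ 1 V)
    (hW : (∫⁻ y, ‖fderiv ℝ V y‖ₑ ^ 2 * ENNReal.ofReal (‖y‖ ^ (ρ - 1))) ≠ ⊤) {ε : ℝ} (hε : 0 < ε) :
    ∃ R₁ : ℝ, 1 ≤ R₁ ∧ ∀ R : ℝ, R₁ ≤ R →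
      ∫⁻ y in closedBall (0 : EuclideanSpace ℝ (Fin 3)) (2 * R) \ ball (0 : EuclideanSpace ℝ (Fin 3)) R, ‖fderiv ℝ V y‖ₑ ^ 2
        ≤ ENNReal.ofReal (ε * R ^ (1 - ρ)) := by
  have ha : ρ - 1 < 0 := by linarith
  have hmeas : Measurable fun y => ‖fderiv ℝ V y‖ₑ ^ 2 :=
    (hV.continuous_fderiv one_ne_zero).measurable.enorm.pow_const 2
  have hfin : ∀ y, ‖fderiv ℝ V y‖ₑ ^ 2 ≠ ∞ := fun y => ENNReal.pow_ne_top enorm_ne_top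
  have h2 : 0 < (2 : ℝ) ^ (1 - ρ) := Real.rpow_pos_of_pos two_pos _
  obtain ⟨L₀, hL₀, hL⟩ := setLIntegral_closedBall_eventually_le_of_weight ha hmeas hfin hW (div_pos hε h2)
  refine ⟨L₀, hL₀, fun R hR => ?_⟩
  have hR0 : 0 ≤ R := by linarith
  have h2R : L₀ ≤ 2 * R := by linarith
  refine (lintegral_mono_set Set.sdiff_subset).trans ((hL (2 * R) h2R).trans (le_of_eq ?_))
  congr 1
  rw [show (-(ρ - 1)) = 1 - ρ by ring, Real.mul_rpow two_pos.le hR0]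
  field_simp

/-- **E-TAIL — nsreg-p2 ROUND-50 `EnergyTail ρ`, text VERBATIM** (`r50/Sketch50.lean` 6c31f8f6e879902e l.148–153): a finite weighted energy
`∫‖DV‖²‖y‖^{ρ−1} < ∞` (`ρ < 1`) has shell energy `∫_{R≤‖y‖≤2R}‖DV‖² ≤ ε R^{1−ρ}` for `R ≥ R₁(ε)` — the E-TAIL replacing the whole budget
`(1−ρ)c/(2+ρ)·(2R)^{1−ρ}`. [folklore] -/
theorem energyTail (ρ : ℝ) :
    ρ < 1 → ∀ (V : EuclideanSpace ℝ (Fin 3) → EuclideanSpace ℝ (Fin 3)), ContDiff ℝ 1 V →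
      (∫⁻ y, ‖fderiv ℝ V y‖ₑ ^ 2 * ENNReal.ofReal (‖y‖ ^ (ρ - 1))) ≠ ⊤ →
        ∀ ε : ℝ, 0 < ε → ∃ R₁ : ℝ, ∀ R : ℝ, R₁ ≤ R →
          ∫⁻ y in closedBall (0 : EuclideanSpace ℝ (Fin 3)) (2 * R) \ ball (0 : EuclideanSpace ℝ (Fin 3)) R, ‖fderiv ℝ V y‖ₑ ^ 2
            ≤ ENNReal.ofReal (ε * R ^ (1 - ρ)) := by
  intro hρ1 V hV hW ε hε
  obtain ⟨R₁, -, h⟩ := setLIntegral_shell_fderiv_sq_eventually_le hρ1 hV hW hε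
  exact ⟨R₁, h⟩

end Summit.NavierStokesRegularity.NavierStokesRegularity.Theorems.PowerGaugeEulerLiouville.Condenser

end
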